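import Summits.Langlands.Langlands.Theses.IrreducibilityBySelfDuality
import Summits.Langlands.Langlands.Theorems.IrreducibilityBySelfDualityGaloisRepOfRegularAlgebraic
import Literature.NumberTheory.Automorphic.ReciprocityGLnUniquenessHolds
import HarnessLib

/-!
# The crux `GaloisRepOfRegularAlgebraic` is exactly HLTT Thm. A (existence) ∧ Varma Cor. 9.3

Support file for crux stmt-Langlands-10785 (route `IrreducibilityBySelfDuality`), line lead
prover-line-stmt-Langlands-10785-c26-0, 2026-08-17.

The crux `Summit.Langlands.Langlands.Theses.IrreducibilityBySelfDuality.GaloisRepOfRegularAlgebraic`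
is the text of lang.S27 (`iff_fact`).  This file records, BY NAME and kernel-checked, that it is
*logically equivalent* to the conjunction of the two printed theorems the tree vendors as named
facts — Harris–Lan–Taylor–Thorne 2016 Thm. A, existence half
(`HarrisLanTaylorThorne2016.theoremA_existence`) and Varma 2024 Cor. 9.3 at the unramified places
(`Varma2024.corollary93_unramified`) — using only proved glue of the tree
(`exists_galoisRep_of_regularAlgebraic_of`, `theoremA_existence_of`,
`Varma2024.corollary93_unramified_of_regularAlgebraic`, the last one resting on the PROVED
uniqueness half `theoremA_uniqueness_holds` and `chebotarev_artinRep_holds`).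

Consequence for the crux chain: every proof of the crux is a proof of both named facts, so no
line for this crux can avoid `theoremA_existence` (rigid cohomology of `U(n,n)` Shimura varieties +
Arthur–Clozel base change) or Varma's theorem; conversely the crux closes in one line the day
`theoremA_existence_holds` and `corollary93_unramified_holds` land (`of_theoremA_and_corollary93`).
-/

set_option linter.dupNamespace false

open scoped NumberField
open NumberField IsDedekindDomain
open Literature.NumberTheory.Automorphic Literature.NumberTheory.GaloisRepresentations

namespace Summit.Langlands.Langlands.Theorems.GaloisRepOfRegularAlgebraic

/-- **The crux is lang.S27, by name.**  `iff_fact` restated with the route declaration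
`GaloisRepOfRegularAlgebraic` on the left (definitional unfolding). [folklore] -/
theorem crux_iff_fact :
    Summit.Langlands.Langlands.Theses.IrreducibilityBySelfDuality.GaloisRepOfRegularAlgebraic ↔
      exists_galoisRep_of_regularAlgebraic := by
  unfold Summit.Langlands.Langlands.Theses.IrreducibilityBySelfDuality.GaloisRepOfRegularAlgebraic
  exact iff_fact

/-- **The crux is exactly HLTT Thm. A (existence) ∧ Varma Cor. 9.3 (unramified places).**
`→`: a representation compatible at every unramified `v ∤ ℓ` is HLTT-compatible
(`theoremA_existence_of`), and Varma's corollary for EVERY HLTT-compatible semisimple `r` follows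
by the proved uniqueness half of Thm. A (`corollary93_unramified_of_regularAlgebraic`);
`←`: `exists_galoisRep_of_regularAlgebraic_of`.  Hence any proof of the crux proves both named
facts. [cite: HarrisLanTaylorThorneRMS2016, Thm. A (p. 3)] [cite: VarmaFMS2024, Cor. 9.3 (p. 32)] -/
theorem iff_theoremA_existence_and_corollary93_unramified :
    Summit.Langlands.Langlands.Theses.IrreducibilityBySelfDuality.GaloisRepOfRegularAlgebraic ↔
      (HarrisLanTaylorThorne2016.theoremA_existence ∧ Varma2024.corollary93_unramified) := by
  rw [crux_iff_fact]
  exact ⟨fun h => ⟨HarrisLanTaylorThorne2016.theoremA_existence_of h,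
      Varma2024.corollary93_unramified_of_regularAlgebraic h⟩,
    fun h => exists_galoisRep_of_regularAlgebraic_of h.1 h.2⟩

/-- **One-line closure recipe**: the crux from the two named facts (the day both `_holds` land,
`of_theoremA_and_corollary93 theoremA_existence_holds corollary93_unramified_holds` closes
stmt-Langlands-10785). [cite: HarrisLanTaylorThorneRMS2016, Thm. A (p. 3)] -/
theorem of_theoremA_and_corollary93 (hA : HarrisLanTaylorThorne2016.theoremA_existence)
    (hV : Varma2024.corollary93_unramified) :
    Summit.Langlands.Langlands.Theses.IrreducibilityBySelfDuality.GaloisRepOfRegularAlgebraic :=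
  iff_theoremA_existence_and_corollary93_unramified.mpr ⟨hA, hV⟩

end Summit.Langlands.Langlands.Theorems.GaloisRepOfRegularAlgebraic
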